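import Summits.ValiantsHypothesis.ValiantsHypothesis.Theorems.GrenetZeonDualUnipotentThreeHalvesRadicalCoarseningTrace
import Summits.ValiantsHypothesis.ValiantsHypothesis.Theorems.GrenetZeonDualUnipotentThreeHalvesWordFlagPencil

/-!
# King–Procesi necklace helper for crux `GrenetZeon.DualUnipotentThreeHalves` (residue R2 `HeavyTopLaw`)

Crux idea card `king-procesi-necklace` (val-idea-28, lens «degeneration / orbit-closure»), price P1 of the critic of
record (val-idea-crit-7, verdict #2): ONE lint-clean helper, Negative-lane / refuter-instrument grade.

**What is proved here (no `sorry`, no new axioms).**  Word currency of the tree (`word`, `WordTame`, `FlagCheap`,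
✓ `flagCheap_iff_wordTame`), plus the tree's Jacobson machinery (`RadicalCoarsening.mem_jacobson_of_traceOrth`,
`exists_jacobson_pow_eq_bot`, `list_prod_mem_pow`):

* §1 word algebra: `word_append`, `word_flatten_replicate` (= powers of a necklace), letter counts of a power.
* §2 the HEIGHT-FREE RATIO OBSTRUCTION: if `(T₀,T₁)` has ANY word profile `c·#T₁(w) ≤ Θ + r·#T₀(w)` on its nonzero
  words, then every NON-NILPOTENT word — in particular every word with NONZERO TRACE (a necklace invariant) — satisfies
  the height-free inequality `c·#T₁(w) ≤ r·#T₀(w)` (`ratio_le_of_profile_of_trace_ne_zero`): powers of the word stay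
  nonzero, and the affine term `Θ` is killed by amplification `w ↦ w^j`.
* §3 the refuter's kill in necklace form: ONE word `w` with `tr(word T₀ T₁ w) ≠ 0` and `T₁`-fraction
  `#T₁(w)/|w| ≥ (k+1)/(n−1)` forbids `WordTame n k T₀ T₁` — for words of ANY length (`not_wordTame_of_trace_word_ne_zero`;
  compare the tree's `not_wordTame_of_word`, which needs `|w| ≤ n − 1` but only `word ≠ 0`), and its pencil form
  `not_flagCheap_of_trace_words` (via ✓ `flagCheap_iff_wordTame`).
* §4 the grading side (gen-0 sketch, now lint-clean): `LevelAdapted` bases make every ratio-rich word traceless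
  (`trace_word_eq_zero_of_levelAdapted`), in any conjugate basis (`trace_word_conj`,
  `not_levelAdapted_conj_of_trace_word_ne_zero`).
* §5 RATIO COMPLETENESS (King's criterion made elementary, Jacobson form): if every `(r:c)`-rich necklace is
  TRACELESS then a word profile of ratio `(r:c)` EXISTS — `∃ Θ, ∀ w, word ≠ 0 → c·#T₁(w) ≤ Θ + r·#T₀(w)`
  (`exists_profile_of_necklace_null`, `Θ = c·(L−1)`, `L` the nilpotency exponent of the radical of the positive-degree
  algebra `Algebra.adjoin ℂ (richWords …)`; hence `WordTame n k` for every `k ≥ (Θ + r(n−1))/(c+r)`,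
  `exists_wordTame_of_necklace_null`).  Mechanism: rich ⊗ rich = rich, so the rich words are trace-orthogonal to the
  algebra they generate, hence radical, hence products of `L` of them vanish; a word of necklace degree `> c(L−1)` cuts
  greedily into `L` rich pieces (`exists_rich_pieces`).

**Reading (the RATIO / HEIGHT split of the card, P2) — now a theorem pair.**  §2 + §5: the necklace traces
`tr w(T₀,T₁)` decide EXACTLY the RATIO clause of a flag certificate (which `(r:c)` admit a profile at all) and are
BLIND to its HEIGHT clause (the word-currency `Θ`, flag-currency level count `p ≲ budget`): nullity gives a profile with
SOME height (`≤ c·(L−1)`, `L ≤ m` by Nakayama on the chain `J^i V` — not formalised), a nonzero rich trace forbids EVERY height.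
Calibration of record ((4,7)-fold, crit-7 16:35Z): `NSeven` is necklace-null at every ratio (triangular pencil) yet
not flag-cheap (✗ p648631) — the law R2 lives in the height clause; the necklace instrument can only ever detect
RATIO-expensive objects (irreducible blocks with a fat non-nilpotent word), which is what S1b's fat blocks must be
tested for.

Nothing here proves R2, the crux, or VP ≠ VNP; 24318 is OPEN.
-/

set_option linter.dupNamespace false

namespace Summit.ValiantsHypothesis.ValiantsHypothesis.Cruxes.DualUnipotentThreeHalves.KingProcesi

open Summit.ValiantsHypothesis.ValiantsHypothesis.Theorems.GrenetZeon.RadicalSplit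
open Summit.ValiantsHypothesis.ValiantsHypothesis.Cruxes.TwoDimCoefficients.DimTwoCases (AffMat IsAffine)

variable {m : ℕ}

/-! ## §1 Word algebra: concatenation, powers of a necklace, letter counts -/

/-- Words multiply under concatenation. [folklore] -/
theorem word_append (T₀ T₁ : Matrix (Fin m) (Fin m) ℂ) (w w' : List Bool) :
    word T₀ T₁ (w ++ w') = word T₀ T₁ w * word T₀ T₁ w' := by
  simp [word, List.map_append, List.prod_append]

/-- The `j`-th power of a necklace is the word of the `j`-fold repetition. [folklore] -/
theorem word_flatten_replicate (T₀ T₁ : Matrix (Fin m) (Fin m) ℂ) (w : List Bool) (j : ℕ) :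
    word T₀ T₁ (List.replicate j w).flatten = word T₀ T₁ w ^ j := by
  induction j with
  | zero => simp [word]
  | succ j ih => rw [List.replicate_succ, List.flatten_cons, word_append, ih, pow_succ']

/-- Letter counts of a repetition. [folklore] -/
theorem count_flatten_replicate (w : List Bool) (j : ℕ) (b : Bool) :
    ((List.replicate j w).flatten).count b = j * w.count b := by
  induction j with
  | zero => simp
  | succ j ih => rw [List.replicate_succ, List.flatten_cons, List.count_append, ih]; ring

/-- `|w| = #T₀(w) + #T₁(w)` for Boolean words. [folklore] -/
theorem length_eq_count_false_add_count_true (w : List Bool) :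
    w.length = w.count false + w.count true := by
  have h := List.count_not_add_count w true
  rw [Bool.not_true] at h
  exact h.symm

/-! ## §2 The height-free ratio obstruction (amplification `w ↦ w^j`) -/

/-- **Ratio bound for non-nilpotent words.**  Under a word profile `c·#T₁ ≤ Θ + r·#T₀` on nonzero words, a word all of
whose powers are nonzero satisfies the HEIGHT-FREE bound `c·#T₁(w) ≤ r·#T₀(w)`: apply the profile to `w^{Θ+1}`.
[this file] -/
theorem ratio_le_of_profile_of_forall_pow_ne_zero (T₀ T₁ : Matrix (Fin m) (Fin m) ℂ) {r c Θ : ℕ}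
    (hW : ∀ w : List Bool, word T₀ T₁ w ≠ 0 → c * w.count true ≤ Θ + r * w.count false)
    (w : List Bool) (hpow : ∀ j : ℕ, word T₀ T₁ w ^ j ≠ 0) :
    c * w.count true ≤ r * w.count false := by
  refine le_of_not_gt fun hlt => ?_
  have h := hW (List.replicate (Θ + 1) w).flatten (by rw [word_flatten_replicate]; exact hpow (Θ + 1))
  rw [count_flatten_replicate, count_flatten_replicate] at h
  have h1 : (Θ + 1) * (r * w.count false + 1) ≤ (Θ + 1) * (c * w.count true) :=
    Nat.mul_le_mul_left (Θ + 1) (Nat.succ_le_of_lt hlt)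
  nlinarith [h, h1]

/-- A matrix with nonzero trace is not nilpotent (`ℂ` is reduced). [folklore] -/
theorem not_isNilpotent_of_trace_ne_zero {M : Matrix (Fin m) (Fin m) ℂ} (h : Matrix.trace M ≠ 0) :
    ¬ IsNilpotent M :=
  fun hM => h (Matrix.isNilpotent_trace_of_isNilpotent hM).eq_zero

/-- All powers of a matrix with nonzero trace are nonzero. [folklore] -/
theorem pow_ne_zero_of_trace_ne_zero {M : Matrix (Fin m) (Fin m) ℂ} (h : Matrix.trace M ≠ 0) (j : ℕ) :
    M ^ j ≠ 0 :=
  fun hj => not_isNilpotent_of_trace_ne_zero h ⟨j, hj⟩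

/-- **Necklace form of the ratio obstruction.**  Under a word profile `c·#T₁ ≤ Θ + r·#T₀` on nonzero words, every word
with NONZERO TRACE satisfies `c·#T₁(w) ≤ r·#T₀(w)` — independently of the height `Θ`. [this file] -/
theorem ratio_le_of_profile_of_trace_ne_zero (T₀ T₁ : Matrix (Fin m) (Fin m) ℂ) {r c Θ : ℕ}
    (hW : ∀ w : List Bool, word T₀ T₁ w ≠ 0 → c * w.count true ≤ Θ + r * w.count false)
    (w : List Bool) (htr : Matrix.trace (word T₀ T₁ w) ≠ 0) :
    c * w.count true ≤ r * w.count false :=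
  ratio_le_of_profile_of_forall_pow_ne_zero T₀ T₁ hW w (pow_ne_zero_of_trace_ne_zero htr)

/-! ## §3 The refuter's kill in necklace currency, and its pencil form -/

/-- **One fat necklace kills word-tameness.**  If some word `w` has `tr(word T₀ T₁ w) ≠ 0`, contains a letter `T₁`, and
has `T₁`-fraction at least `(k+1)/(n−1)` — `(k+1)·|w| ≤ (n−1)·#T₁(w)` — then `¬ WordTame n k T₀ T₁`.  No bound on
`|w|` is needed (contrast ✓ `not_wordTame_of_word`). [this file] -/
theorem not_wordTame_of_trace_word_ne_zero {n k : ℕ} (T₀ T₁ : Matrix (Fin m) (Fin m) ℂ) (w : List Bool)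
    (htr : Matrix.trace (word T₀ T₁ w) ≠ 0) (ht : 0 < w.count true)
    (hk : (k + 1) * w.length ≤ (n - 1) * w.count true) : ¬ WordTame n k T₀ T₁ := by
  rintro ⟨r, c, Θ, hc, hbud, hW⟩
  have hrat := ratio_le_of_profile_of_trace_ne_zero T₀ T₁ hW w htr
  rw [length_eq_count_false_add_count_true] at hk
  have hcr : 0 < c + r := by omega
  have hlt : Θ + r * (n - 1) < (k + 1) * (c + r) :=
    (Nat.div_lt_iff_lt_mul hcr).1 (Nat.lt_succ_of_le hbud)
  have h1 : (k + 1) * (c * w.count true) ≤ (k + 1) * (r * w.count false) := Nat.mul_le_mul_left _ hrat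
  have h2 : r * ((k + 1) * (w.count false + w.count true)) ≤ r * ((n - 1) * w.count true) :=
    Nat.mul_le_mul_left _ hk
  have h3 : (k + 1) * (c + r) * w.count true ≤ r * (n - 1) * w.count true := by nlinarith [h1, h2]
  have h4 : (k + 1) * (c + r) ≤ r * (n - 1) := Nat.le_of_mul_le_mul_right h3 ht
  omega

/-- **Pencil form (ENEMY CRITERION, necklace version).**  If inside EVERY direction space `K` with `(k+1)·n < dim K`
some line `x + s·v`, `v ∈ K`, carries a necklace `w` in `{N(x), N_lin(v)}` with NONZERO TRACE and `N_lin`-fraction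
`≥ (k+1)/(n−1)`, then the affine pencil `N` is not flag-cheap. [this file; ✓ `flagCheap_iff_wordTame`] -/
theorem not_flagCheap_of_trace_words {n : ℕ} (N : AffMat n m) (hN : IsAffine N)
    (h : ∀ (K : Submodule ℂ (Fin n × Fin n → ℂ)) (k : ℕ), (k + 1) * n < Module.finrank ℂ K →
      ∃ x v : Fin n × Fin n → ℂ, v ∈ K ∧ ∃ w : List Bool,
        Matrix.trace (word (N.map (MvPolynomial.eval x)) (linPart N v) w) ≠ 0 ∧ 0 < w.count true ∧
          (k + 1) * w.length ≤ (n - 1) * w.count true) :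
    ¬ FlagCheap n m N := by
  rw [flagCheap_iff_wordTame N hN]
  rintro ⟨K, k, hdim, hW⟩
  obtain ⟨x, v, hv, w, hw, ht, hl⟩ := h K k hdim
  exact not_wordTame_of_trace_word_ne_zero _ _ w hw ht hl (hW x v hv)

/-! ## §4 The grading side: level-adapted bases make ratio-rich necklaces traceless -/

/-- `(P, Q)` is LEVEL-ADAPTED with drop `r` and climb `c` in the standard basis: `P` lowers the level by at most `r`,
`Q` raises it by at least `c` (the `e = 0 / e = 1` clauses of `FlagAdapted` with `c = a + 1 − r`). -/
def LevelAdapted (lvl : Fin m → ℕ) (r c : ℕ) (P Q : Matrix (Fin m) (Fin m) ℂ) : Prop :=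
  (∀ i j, P i j ≠ 0 → lvl j ≤ lvl i + r) ∧ (∀ i j, Q i j ≠ 0 → lvl j + c ≤ lvl i)

/-- Weight bookkeeping along a word: every nonzero entry `(word P Q w) i j` satisfies
`lvl j + c·#Q(w) ≤ lvl i + r·#P(w)`. [folklore] -/
theorem levels_of_word_ne_zero (lvl : Fin m → ℕ) (r c : ℕ) (P Q : Matrix (Fin m) (Fin m) ℂ)
    (h : LevelAdapted lvl r c P Q) :
    ∀ (w : List Bool) (i j : Fin m), word P Q w i j ≠ 0 →
      lvl j + c * w.count true ≤ lvl i + r * w.count false := by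
  intro w
  induction w with
  | nil =>
    intro i j hij
    by_cases h' : i = j
    · subst h'; simp
    · exfalso; apply hij; simp [word, h']
  | cons b w ih =>
    intro i j hij
    rw [word_cons, Matrix.mul_apply] at hij
    obtain ⟨l, -, hl⟩ := Finset.exists_ne_zero_of_sum_ne_zero hij
    have h1 : (if b then Q else P) i l ≠ 0 := left_ne_zero_of_mul hl
    have h2 : word P Q w l j ≠ 0 := right_ne_zero_of_mul hl
    have ih' := ih l j h2
    cases b with
    | true =>
      rw [if_pos rfl] at h1
      have hQ := h.2 i l h1
      rw [List.count_cons_self, List.count_cons_of_ne (by decide)]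
      nlinarith [hQ, ih']
    | false =>
      rw [if_neg (by decide)] at h1
      have hP := h.1 i l h1
      rw [List.count_cons_self, List.count_cons_of_ne (by decide)]
      nlinarith [hP, ih']

/-- **Easy direction of the King–Procesi criterion.**  If `(P,Q)` is level-adapted with drop `r` / climb `c`, every
RATIO-RICH word (`r·#P < c·#Q`) is traceless (indeed has zero diagonal). [this file] -/
theorem trace_word_eq_zero_of_levelAdapted (lvl : Fin m → ℕ) (r c : ℕ) (P Q : Matrix (Fin m) (Fin m) ℂ)
    (h : LevelAdapted lvl r c P Q) (w : List Bool) (hw : r * w.count false < c * w.count true) :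
    Matrix.trace (word P Q w) = 0 := by
  unfold Matrix.trace
  apply Finset.sum_eq_zero
  intro i _
  by_contra hi
  have := levels_of_word_ne_zero lvl r c P Q h w i i (by simpa [Matrix.diag] using hi)
  omega

/-- Words are conjugation-equivariant. [folklore] -/
theorem word_conj (g : (Matrix (Fin m) (Fin m) ℂ)ˣ) (P Q : Matrix (Fin m) (Fin m) ℂ) (w : List Bool) :
    word ((g : Matrix (Fin m) (Fin m) ℂ) * P * ((g⁻¹ : (Matrix (Fin m) (Fin m) ℂ)ˣ) : Matrix (Fin m) (Fin m) ℂ))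
         ((g : Matrix (Fin m) (Fin m) ℂ) * Q * ((g⁻¹ : (Matrix (Fin m) (Fin m) ℂ)ˣ) : Matrix (Fin m) (Fin m) ℂ)) w =
      (g : Matrix (Fin m) (Fin m) ℂ) * word P Q w * ((g⁻¹ : (Matrix (Fin m) (Fin m) ℂ)ˣ) : Matrix (Fin m) (Fin m) ℂ) := by
  induction w with
  | nil => simp [word]
  | cons b w ih =>
    rw [word_cons, word_cons, ih]
    cases b <;> simp [Matrix.mul_assoc]

/-- Necklace traces are conjugation invariants. [folklore] -/
theorem trace_word_conj (g : (Matrix (Fin m) (Fin m) ℂ)ˣ) (P Q : Matrix (Fin m) (Fin m) ℂ) (w : List Bool) :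
    Matrix.trace (word ((g : Matrix (Fin m) (Fin m) ℂ) * P * ((g⁻¹ : (Matrix (Fin m) (Fin m) ℂ)ˣ) : Matrix (Fin m) (Fin m) ℂ))
         ((g : Matrix (Fin m) (Fin m) ℂ) * Q * ((g⁻¹ : (Matrix (Fin m) (Fin m) ℂ)ˣ) : Matrix (Fin m) (Fin m) ℂ)) w) =
      Matrix.trace (word P Q w) := by
  rw [word_conj, Matrix.trace_mul_cycle, Units.inv_mul, Matrix.one_mul]

/-- **The grading obstruction, basis-free.**  If in SOME basis `(P,Q)` is level-adapted with drop `r` / climb `c`,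
every ratio-rich necklace is traceless; contrapositively ONE ratio-rich necklace with nonzero trace forbids every
`(r:c)`-adapted grading in every basis. [this file] -/
theorem not_levelAdapted_conj_of_trace_word_ne_zero (g : (Matrix (Fin m) (Fin m) ℂ)ˣ) (lvl : Fin m → ℕ) (r c : ℕ)
    (P Q : Matrix (Fin m) (Fin m) ℂ) (w : List Bool) (hw : r * w.count false < c * w.count true)
    (htr : Matrix.trace (word P Q w) ≠ 0) :
    ¬ LevelAdapted lvl r c
        ((g : Matrix (Fin m) (Fin m) ℂ) * P * ((g⁻¹ : (Matrix (Fin m) (Fin m) ℂ)ˣ) : Matrix (Fin m) (Fin m) ℂ))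
        ((g : Matrix (Fin m) (Fin m) ℂ) * Q * ((g⁻¹ : (Matrix (Fin m) (Fin m) ℂ)ˣ) : Matrix (Fin m) (Fin m) ℂ)) := by
  intro h
  apply htr
  rw [← trace_word_conj g]
  exact trace_word_eq_zero_of_levelAdapted lvl r c _ _ h w hw

/-! ## §5 Ratio completeness: necklace-null at ratio `(r:c)` ⇒ a word profile of that ratio
(King's criterion made elementary — the Jacobson-radical form, over the tree's `RadicalCoarsening` machinery) -/

section Completeness

open Summit.ValiantsHypothesis.ValiantsHypothesis.Theorems.GrenetZeon.RadicalCoarsening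
  (mem_jacobson_of_traceOrth exists_jacobson_pow_eq_bot list_prod_mem_pow)

/-- A word is RATIO-RICH for `(r:c)` («positive necklace degree») if `r·#T₀(w) < c·#T₁(w)`. -/
def Rich (r c : ℕ) (w : List Bool) : Prop := r * w.count false < c * w.count true

theorem rich_append {r c : ℕ} {w w' : List Bool} (hw : Rich r c w) (hw' : Rich r c w') : Rich r c (w ++ w') := by
  unfold Rich at *
  rw [List.count_append, List.count_append, mul_add, mul_add]
  omega

theorem not_rich_nil (r c : ℕ) : ¬ Rich r c ([] : List Bool) := by
  simp [Rich]

/-- Words of a concatenation of pieces. [folklore] -/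
theorem word_flatten (T₀ T₁ : Matrix (Fin m) (Fin m) ℂ) (ps : List (List Bool)) :
    word T₀ T₁ ps.flatten = (ps.map (word T₀ T₁)).prod := by
  induction ps with
  | nil => simp [word]
  | cons p ps ih => rw [List.flatten_cons, word_append, ih, List.map_cons, List.prod_cons]

/-- Letter counts grow by at most one per letter taken. [folklore] -/
theorem count_take_succ_le (w : List Bool) (j : ℕ) (b : Bool) :
    (w.take (j + 1)).count b ≤ (w.take j).count b + 1 := by
  rw [List.take_add_one, List.count_append]
  have : (w[j]?.toList).count b ≤ 1 := by
    cases w[j]? with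
    | none => simp
    | some a => cases a <;> cases b <;> simp
  omega

theorem count_take_le_succ (w : List Bool) (j : ℕ) (b : Bool) :
    (w.take j).count b ≤ (w.take (j + 1)).count b := by
  rw [List.take_add_one, List.count_append]
  omega

/-- **Shortest rich prefix.**  A rich word splits as `p ++ u` with `p` rich of necklace degree `≤ c`
(`c·#T₁(p) ≤ r·#T₀(p) + c`). [this file] -/
theorem exists_rich_prefix {r c : ℕ} (w : List Bool) (hw : Rich r c w) :
    ∃ p u : List Bool, w = p ++ u ∧ Rich r c p ∧ c * p.count true ≤ r * p.count false + c := by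
  classical
  have hex : ∃ j, Rich r c (w.take j) := ⟨w.length, by rwa [List.take_length]⟩
  have hpos : Nat.find hex ≠ 0 := by
    intro h0
    have h := Nat.find_spec hex
    rw [h0, List.take_zero] at h
    exact not_rich_nil r c h
  obtain ⟨j, hj⟩ := Nat.exists_eq_succ_of_ne_zero hpos
  have hrich : Rich r c (w.take (j + 1)) := by
    have h := Nat.find_spec hex
    rwa [hj] at h
  have hmin : ¬ Rich r c (w.take j) := Nat.find_min hex (by rw [hj]; exact Nat.lt_succ_self j)
  refine ⟨w.take (j + 1), w.drop (j + 1), (List.take_append_drop _ _).symm, hrich, ?_⟩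
  unfold Rich at hmin
  have h1 := count_take_succ_le w j true
  have h2 := count_take_le_succ w j false
  have h3 : c * (w.take (j + 1)).count true ≤ c * ((w.take j).count true + 1) := Nat.mul_le_mul_left c h1
  have h4 : r * (w.take j).count false ≤ r * (w.take (j + 1)).count false := Nat.mul_le_mul_left r h2
  rw [mul_add, mul_one] at h3
  omega

/-- **Cutting lemma.**  A word of necklace degree `> c·(K−1)` — precisely `r·#T₀ + c·K < c·#T₁ + c` — is a
concatenation of `K` RICH pieces and a remainder. [this file] -/
theorem exists_rich_pieces {r c : ℕ} :
    ∀ (K : ℕ) (w : List Bool), r * w.count false + c * K < c * w.count true + c →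
      ∃ (ps : List (List Bool)) (u : List Bool), ps.length = K ∧ (∀ p ∈ ps, Rich r c p) ∧ w = ps.flatten ++ u := by
  intro K
  induction K with
  | zero =>
    intro w _
    exact ⟨[], w, rfl, fun p hp => by simp at hp, by simp⟩
  | succ K ih =>
    intro w hw
    have hwr : Rich r c w := by unfold Rich; nlinarith [hw]
    obtain ⟨p, u, rfl, hp, hdeg⟩ := exists_rich_prefix w hwr
    rw [List.count_append, List.count_append] at hw
    have hu : r * u.count false + c * K < c * u.count true + c := by nlinarith [hw, hdeg]
    obtain ⟨ps, u', hlen, hps, rfl⟩ := ih u hu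
    refine ⟨p :: ps, u', by rw [List.length_cons, hlen], ?_, by simp⟩
    intro q hq
    rcases List.mem_cons.1 hq with rfl | hq
    · exact hp
    · exact hps q hq

variable (T₀ T₁ : Matrix (Fin m) (Fin m) ℂ) (r c : ℕ)

/-- The rich words of `(T₀,T₁)` as a set of matrices; `Algebra.adjoin ℂ (richWords …)` is the POSITIVE-DEGREE algebra
`ℂ·1 ⊕ A_{≥1}` of the card. -/
def richWords : Set (Matrix (Fin m) (Fin m) ℂ) := {M | ∃ w : List Bool, Rich r c w ∧ M = word T₀ T₁ w}

/-- The monoid generated by the rich words is `{1} ∪ richWords` (degrees add). [this file] -/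
theorem eq_one_or_rich_of_mem_closure {b : Matrix (Fin m) (Fin m) ℂ} (hb : b ∈ Submonoid.closure (richWords T₀ T₁ r c)) :
    b = 1 ∨ ∃ w : List Bool, Rich r c w ∧ b = word T₀ T₁ w := by
  induction hb using Submonoid.closure_induction with
  | mem x hx => exact Or.inr hx
  | one => exact Or.inl rfl
  | mul x y _ _ ihx ihy =>
    rcases ihx with rfl | ⟨w, hw, rfl⟩
    · rw [one_mul]; exact ihy
    · rcases ihy with rfl | ⟨w', hw', rfl⟩
      · exact Or.inr ⟨w, hw, by rw [mul_one]⟩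
      · exact Or.inr ⟨w ++ w', rich_append hw hw', (word_append T₀ T₁ w w').symm⟩

/-- **Necklace-null ⇒ trace-orthogonal.**  If every rich necklace is traceless, every rich word is trace-orthogonal to
the whole positive-degree algebra. [this file] -/
theorem traceOrth_adjoin_of_null (hnull : ∀ w : List Bool, Rich r c w → Matrix.trace (word T₀ T₁ w) = 0)
    {w : List Bool} (hw : Rich r c w) :
    ∀ b ∈ Algebra.adjoin ℂ (richWords T₀ T₁ r c), Matrix.trace (word T₀ T₁ w * b) = 0 := by
  intro b hb
  have hb' : b ∈ Submodule.span ℂ (Submonoid.closure (richWords T₀ T₁ r c) : Set (Matrix (Fin m) (Fin m) ℂ)) := by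
    rw [← Algebra.adjoin_eq_span]; exact hb
  clear hb
  induction hb' using Submodule.span_induction with
  | mem x hx =>
    rcases eq_one_or_rich_of_mem_closure T₀ T₁ r c hx with rfl | ⟨w', hw', rfl⟩
    · rw [mul_one]; exact hnull w hw
    · rw [← word_append]; exact hnull _ (rich_append hw hw')
  | zero => rw [mul_zero, Matrix.trace_zero]
  | add x y _ _ hx hy => rw [mul_add, Matrix.trace_add, hx, hy, add_zero]
  | smul a x _ hx => rw [mul_smul_comm, Matrix.trace_smul, hx, smul_zero]

/-- **Rich words are radical.**  Under necklace-nullity every rich word lies in the Jacobson radical of the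
positive-degree algebra (tree: `RadicalCoarsening.mem_jacobson_of_traceOrth`). [this file] -/
theorem word_mem_jacobson_of_null (hnull : ∀ w : List Bool, Rich r c w → Matrix.trace (word T₀ T₁ w) = 0)
    {w : List Bool} (hw : Rich r c w) :
    (⟨word T₀ T₁ w, Algebra.subset_adjoin ⟨w, hw, rfl⟩⟩ : Algebra.adjoin ℂ (richWords T₀ T₁ r c)) ∈
      Ideal.jacobson (⊥ : Ideal (Algebra.adjoin ℂ (richWords T₀ T₁ r c))) :=
  mem_jacobson_of_traceOrth _ _ (traceOrth_adjoin_of_null T₀ T₁ r c hnull hw)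

/-- **Products of `L` rich words vanish**, `L` the nilpotency exponent of the radical of the positive-degree algebra
(tree: `exists_jacobson_pow_eq_bot`, `list_prod_mem_pow`). [this file] -/
theorem prod_words_eq_zero_of_null (hnull : ∀ w : List Bool, Rich r c w → Matrix.trace (word T₀ T₁ w) = 0)
    {L : ℕ} (hL : (Ideal.jacobson (⊥ : Ideal (Algebra.adjoin ℂ (richWords T₀ T₁ r c)))) ^ L = ⊥)
    (ps : List (List Bool)) (hps : ∀ p ∈ ps, Rich r c p) (hlen : ps.length = L) :
    (ps.map (word T₀ T₁)).prod = 0 := by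
  set 𝒜 := Algebra.adjoin ℂ (richWords T₀ T₁ r c) with h𝒜
  let F : {p // p ∈ ps} → 𝒜 := fun x => ⟨word T₀ T₁ x.1, Algebra.subset_adjoin ⟨x.1, hps x.1 x.2, rfl⟩⟩
  set l : List 𝒜 := ps.attach.map F with hl
  have hmem := list_prod_mem_pow 𝒜 (Ideal.jacobson (⊥ : Ideal 𝒜)) l (fun x hx => by
    obtain ⟨y, -, rfl⟩ := List.mem_map.1 hx
    exact word_mem_jacobson_of_null T₀ T₁ r c hnull (hps y.1 y.2))
  have hlenl : l.length = L := by rw [hl, List.length_map, List.length_attach, hlen]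
  rw [hlenl, hL, Ideal.mem_bot] at hmem
  have hval : ((l.prod : 𝒜) : Matrix (Fin m) (Fin m) ℂ) = (ps.map (word T₀ T₁)).prod := by
    rw [SubmonoidClass.coe_list_prod, hl, List.map_map]
    have hcomp : (Subtype.val ∘ F : {p // p ∈ ps} → Matrix (Fin m) (Fin m) ℂ) = word T₀ T₁ ∘ Subtype.val := by
      funext x; rfl
    rw [hcomp, ← List.map_map, List.attach_map_subtype_val]
  rw [← hval, hmem]
  rfl

/-- **RATIO COMPLETENESS (King–Procesi, elementary form).**  If every `(r:c)`-rich necklace of `(T₀,T₁)` is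
TRACELESS, then `(T₀,T₁)` has a word profile of ratio `(r:c)`: for some height `Θ` (here `Θ = c·(L−1)`, `L` the
nilpotency exponent of the radical of the positive-degree algebra), every NONZERO word satisfies
`c·#T₁(w) ≤ Θ + r·#T₀(w)`.  With §2 this says: necklace traces decide exactly the RATIO clause of a flag certificate
and are blind to its HEIGHT clause. [this file; King 1994 §2, Procesi 1976 — here via Wedderburn–Artin-free Jacobson
nilpotency, tree `RadicalCoarsening`] -/
theorem exists_profile_of_necklace_null
    (hnull : ∀ w : List Bool, Rich r c w → Matrix.trace (word T₀ T₁ w) = 0) :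
    ∃ Θ : ℕ, ∀ w : List Bool, word T₀ T₁ w ≠ 0 → c * w.count true ≤ Θ + r * w.count false := by
  obtain ⟨L, hL⟩ := exists_jacobson_pow_eq_bot (Algebra.adjoin ℂ (richWords T₀ T₁ r c))
  refine ⟨c * (L - 1), fun w hw => ?_⟩
  refine le_of_not_gt fun hlt => ?_
  apply hw
  have hcut : r * w.count false + c * L < c * w.count true + c := by
    rcases Nat.eq_zero_or_pos L with rfl | hLpos
    · omega
    · obtain ⟨L', rfl⟩ := Nat.exists_eq_add_of_le hLpos
      rw [Nat.add_sub_cancel_left] at hlt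
      nlinarith [hlt]
  obtain ⟨ps, u, hlen, hps, rfl⟩ := exists_rich_pieces L w hcut
  rw [word_append, word_flatten, prod_words_eq_zero_of_null T₀ T₁ r c hnull hL ps hps hlen, zero_mul]

/-- **The criterion, both directions, in `WordTame` currency.**  Necklace-nullity at ratio `(r:c)` with `1 ≤ c` gives
`WordTame n k T₀ T₁` for every budget `k ≥ (Θ + r(n−1))/(c+r)` (some `Θ`); conversely (§3) one rich necklace with
nonzero trace and `T₁`-fraction `≥ (k+1)/(n−1)` forbids `WordTame n k`. [this file] -/
theorem exists_wordTame_of_necklace_null (hc : 1 ≤ c)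
    (hnull : ∀ w : List Bool, Rich r c w → Matrix.trace (word T₀ T₁ w) = 0) :
    ∃ Θ : ℕ, ∀ n k : ℕ, (Θ + r * (n - 1)) / (c + r) ≤ k → WordTame n k T₀ T₁ := by
  obtain ⟨Θ, hΘ⟩ := exists_profile_of_necklace_null T₀ T₁ r c hnull
  exact ⟨Θ, fun n k hk => ⟨r, c, Θ, hc, hk, hΘ⟩⟩

end Completeness

end Summit.ValiantsHypothesis.ValiantsHypothesis.Cruxes.DualUnipotentThreeHalves.KingProcesi
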